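import Literature.AlgebraicGeometry.HodgeTheory.KodairaSpencerObstructionClass
import Literature.AlgebraicGeometry.HodgeTheory.AtiyahClassCompare
import Literature.AlgebraicGeometry.Modules.TensorSheafHomIso
import Literature.AlgebraicGeometry.Modules.TensorBraiding
import Literature.AlgebraicGeometry.Modules.SheafHomTranspose
import Literature.AlgebraicGeometry.Modules.TensorUnitors
import Literature.AlgebraicGeometry.Modules.ModulesGrothendieckAbelian
import Literature.AlgebraicGeometry.Modules.SheafHomExact
import Literature.AlgebraicGeometry.Modules.Biduality
import Literature.AlgebraicGeometry.Modules.SheafHomFrames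
import Literature.Algebra.Homology.ExtMapExactFunctorNaturality
import Mathlib.Algebra.Homology.DerivedCategory.Ext.Map
import HarnessLib

/-!
# The obstruction class `ob_κ(E) = (id_E ⊗ κ) ∘ At(E)` in `𝓗om(E^∨, –)`-form

Layer `Literature/AlgebraicGeometry/HodgeTheory` (continuation of `HodgeTheory/KodairaSpencerObstructionClass`), with a short
`Modules`-layer preamble. THEOREMS ONLY (no definition, no named fact, no `instance`, no notation, no `sorry`).

Huybrechts–Thomas [HuybrechtsThomas2010, Main Theorem and Cor. 3.4]: «there is a deformation `E` of `E₀` if and only if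
`0 = (id_{E₀} ⊗ κ(X₀/X)) ∘ A(E₀) ∈ Ext²_{X₀}(E₀, E₀ ⊗ I)`».  The tree types this class TWICE for a finite locally free `E` on an
`S`-scheme `X` and `κ ∈ Ext¹(Ω¹_{X/S}, 𝒪_X)` (`I = 𝒪_X`):

* `HodgeTheory.kodairaSpencerObstruction hΩ hE κ = At'(E) · (𝓗om(𝒯, E) ≅ E ⊗ Ω¹) · (E ⊗ κ) · (E ⊗ 𝒪 ≅ E)` — the twist by the
  exact functor `E ⊗ –` (`Modules.tensorBifunctor`), which needs `Ω¹_{X/S}` finite locally free (`hΩ`);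
* the «`𝓗om(E^∨, –)`-form» `At(E) · 𝓗om(E^∨, κ) · (E^∨∨ ≅ E)⁻¹` — the twist by the exact functor `𝓗om(E^∨, –)`
  (`Modules.sheafHomFunctor (dual E)`, exact for `E` finite locally free; `At(E) ∈ Ext¹(E, 𝓗om(E^∨, Ω¹))` is the tree's
  `HodgeTheory.atiyahClass`), which needs no hypothesis on `Ω¹` and is the form used problem-side
  (`Summits/…/BlochSeedDiscOne/StaticAlongTW.obstructionMap`, not imported here).

**`kodairaSpencerObstruction_eq_sheafHom_form`** (§2) proves the two agree.  Ingredients: the tree's comparison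
`At'(E) = At(E) · (transpose ≫ 𝓗om(𝒯, ev_E)⁻¹)` (`atiyahClass'_eq`, [BuchweitzFlenner2003, §1, §3]); the natural isomorphism
`θ : E ⊗ – ≅ 𝓗om(E^∨, –)` («`𝓗om(𝓔, 𝓕) ≅ 𝓔^∨ ⊗ 𝓕` for `𝓔` locally free of finite rank», [Hartshorne1977, II Ex. 5.1 (b)];
`Modules.tensorSheafHomDualNatTrans`) and the NATURALITY of `κ ↦ F(κ)` on `Ext` in the exact functor `F`
(`Algebra/Homology/ExtMapExactFunctorNaturality.mapExactFunctor_natTrans`, [Weibel1994, §2.4]); and two identities between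
degree-`0` maps, proved in §1 on elementary tensors (`Modules.tensorObj_hom_ext`):

* §1 `tensorUnitRightIso_hom_app_tmulSection` — **`ρ_E(s ⊗ a) = a • s`** (section formula of the unitor of `Modules/TensorUnitors`,
  by the triangle identity of the sheafification adjunction; [StacksProject, Tag 01CA] «`𝓕 ⊗ 𝒪_X = 𝓕`»);
  `tensorUnitRightIso_hom_comp_toBidual` — **`ρ_E ≫ ev_E = θ_{𝒪}`** (`e ⊗ a ↦ a e ↦ (λ ↦ a λ(e))`);
  `tensorComm_tensorSheafHomDualIso_transposeDual` — **`β ≫ θ_{E,L} ≫ (–)^∨ = θ_{L,E} ≫ 𝓗om(L^∨, ev_E)`** as maps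
  `L ⊗ E → 𝓗om(L^∨, E^∨∨)` (`l ⊗ e ↦ (ν ↦ (μ ↦ μ(e) ν(l)))` both ways; [Hartshorne1977, II Ex. 5.1 (a), (b)]).

## References

* D. Huybrechts, R. P. Thomas, *Deformation-obstruction theory for complexes via Atiyah and Kodaira–Spencer classes*,
  Math. Ann. 346 (2010), Main Theorem and Cor. 3.4 (arXiv:0805.3527, pp. 3, 10). [HuybrechtsThomas2010]
* R.-O. Buchweitz, H. Flenner, *A semiregularity map for modules and applications to deformations*, Compositio Math. 137
  (2003), §1, §3 (the Atiyah class). [BuchweitzFlenner2003]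
* R. Hartshorne, *Algebraic Geometry*, GTM 52 (1977), II Ex. 5.1 (a), (b) (p. 123). [Hartshorne1977]
* C. A. Weibel, *An introduction to homological algebra* (1994), §2.4 (naturality of δ-functors). [Weibel1994]
* The Stacks Project, Tag 01CA (tensor product of modules, `𝓕 ⊗ 𝒪_X = 𝓕`). [StacksProject]
-/

noncomputable section

set_option backward.isDefEq.respectTransparency false
set_option autoImplicit false

open CategoryTheory AlgebraicGeometry Opposite TopologicalSpace MonoidalCategory
open scoped TensorProduct

universe u

/-! ### §1 Degree-`0` identities on elementary tensors (layer `Modules`) -/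

namespace Literature.AlgebraicGeometry.Modules

variable {X : Scheme.{u}}

/-- **`ρ_E(s ⊗ a) = a • s`**: the unit isomorphism `E ⊗ 𝒪_X ≅ E` of `Modules/TensorUnitors` on an elementary tensor of sections
(unit naturality and the triangle identity of the sheafification adjunction reduce it to Mathlib's presheaf unitor
`m ⊗ r ↦ r • m`). [cite: StacksProject, Tag 01CA (functorial isomorphism 𝓕 ⊗ 𝒪_X = 𝓕)] -/
theorem tensorUnitRightIso_hom_app_tmulSection (E : X.Modules) (U : X.Opens) (s : secMod E U)
    (a : secMod (unitModule X) U) :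
    (tensorUnitRightIso E).hom.app U (tmulSection E (unitModule X) U s a) = (a : Γ(X, U)) • (s : Γ(E, U)) := by
  have hρ : (presheafTensorUnitRightIso E).hom.app (op U) (s ⊗ₜ[secRing X U] a) =
      (a : Γ(X, U)) • (s : Γ(E, U)) :=
    ModuleCat.MonoidalCategory.rightUnitor_hom_apply s a
  have h := congrArg (fun α => ((modulesSheafifyAdjunction X).counit.app E).val.app (op U)
      (α.app (op U) (s ⊗ₜ[secRing X U] a)))
    ((modulesSheafifyAdjunction X).unit.naturality (presheafTensorUnitRightIso E).hom)
  have ht := congrArg (fun α => α.app (op U)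
      ((presheafTensorUnitRightIso E).hom.app (op U) (s ⊗ₜ[secRing X U] a)))
    ((modulesSheafifyAdjunction X).right_triangle_components E)
  simp only [Functor.id_map, Functor.comp_map, PresheafOfModules.comp_app, CategoryTheory.comp_apply,
    PresheafOfModules.id_app] at h ht
  rw [← hρ]
  refine Eq.trans ?_ ht
  refine Eq.trans ?_ h.symm
  rfl

/-- **`ρ_E ≫ ev_E = θ_𝒪 : E ⊗ 𝒪_X → E^∨∨`**: `e ⊗ a ↦ a • e ↦ (μ ↦ a μ(e))` equals `e ⊗ a ↦ (μ ↦ μ(e) a)` (the tree's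
`tensorSheafHomDualIso E 𝒪`, «`𝓗om(𝓔, 𝓕) ≅ 𝓔^∨ ⊗ 𝓕`» at `𝓕 = 𝒪_X`, and the biduality map `ev`).
[cite: Hartshorne1977, II Ex. 5.1 (a), (b) (p. 123)] -/
theorem tensorUnitRightIso_hom_comp_toBidual (E : X.Modules) (hE : Motives.IsFiniteLocallyFree E) :
    (tensorUnitRightIso E).hom ≫ toBidual E (unitModule X) =
      (tensorSheafHomDualIso E (unitModule X) hE).hom := by
  apply tensorObj_hom_ext
  intro U s a
  rw [tensorSheafHomDualIso_hom_app_tmulSection]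
  change (toBidual E (unitModule X)).app U ((tensorUnitRightIso E).hom.app U (tmulSection E (unitModule X) U s a)) = _
  rw [tensorUnitRightIso_hom_app_tmulSection, Scheme.Modules.Hom.app_smul, toBidual_app_apply]
  -- both sides are morphisms `E^∨|_U → 𝒪|_U`; compare values on `μ ∈ Γ(E^∨, W)`
  change ((show Γ(X, U) from a) • (evalAt (M := unitModule X) (s : Γ(E, U)) :
      (dual E).over U ⟶ (unitModule X).over U)) = twistHomOfSections E (unitModule X) U s a
  refine hom_ext_of_appLE fun W k (μ : E.over W ⟶ (unitModule X).over W) => ?_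
  rw [appLE_smul, appLE_evalAt, appLE_twistHomOfSections]
  change X.presheaf.map k.op (show Γ(X, U) from a) * (show Γ(X, W) from appLE μ (𝟙 W) (E.presheaf.map k.op s)) =
    (show Γ(X, W) from appLE μ (𝟙 W) (E.presheaf.map k.op s)) * X.presheaf.map k.op (show Γ(X, U) from a)
  exact mul_comm _ _

/-- **Transposition exchanges the two twisting isomorphisms**: `β_{L,E} ≫ θ_{E,L} ≫ (–)^∨ = θ_{L,E} ≫ 𝓗om(L^∨, ev_E)` as maps
`L ⊗ E → 𝓗om(L^∨, E^∨∨)` — on `l ⊗ e` both give `ν ↦ (μ ↦ μ(e) · ν(l))` (`θ_{E,L}(e ⊗ l) = (μ ↦ μ(e) l)`, transposed;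
`θ_{L,E}(l ⊗ e) = (ν ↦ ν(l) e)`, followed by `ev`). [cite: Hartshorne1977, II Ex. 5.1 (a), (b) (p. 123)] -/
@[reassoc]
theorem tensorComm_tensorSheafHomDualIso_transposeDual (L E : X.Modules)
    (hL : Motives.IsFiniteLocallyFree L) (hE : Motives.IsFiniteLocallyFree E) :
    (tensorComm L E).hom ≫ (tensorSheafHomDualIso E L hE).hom ≫ transposeDual (dual E) L =
      (tensorSheafHomDualIso L E hL).hom ≫ sheafHomMap (dual L) (toBidual E (unitModule X)) := by
  apply tensorObj_hom_ext
  intro U l s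
  change (transposeDual (dual E) L).app U ((tensorSheafHomDualIso E L hE).hom.app U
      ((tensorComm L E).hom.app U (tmulSection L E U l s))) =
    (sheafHomMap (dual L) (toBidual E (unitModule X))).app U
      ((tensorSheafHomDualIso L E hL).hom.app U (tmulSection L E U l s))
  rw [tensorComm_hom_app_tmulSection, tensorSheafHomDualIso_hom_app_tmulSection,
    tensorSheafHomDualIso_hom_app_tmulSection, sheafHomMap_app_apply, transposeHom_app_apply]
  -- both sides are morphisms `L^∨|_U → E^∨∨|_U`; compare values on `ν ∈ Γ(L^∨, W)`
  refine hom_ext_of_appLE fun W k (ν : L.over W ⟶ (unitModule X).over W) => ?_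
  rw [appLE_precompOver, appLE_comp_over_map, toBidual_app_apply, appLE_twistHomOfSections]
  -- both sides are morphisms `E^∨|_W → 𝒪|_W`; compare values on `μ ∈ Γ(E^∨, W')`
  change (restrictHom k (twistHomOfSections E L U s l) ≫ ν : (dual E).over W ⟶ (unitModule X).over W) =
    evalAt (M := unitModule X)
      ((show Γ(X, W) from appLE ν (𝟙 W) (L.presheaf.map k.op l)) • E.presheaf.map k.op (s : Γ(E, U)))
  refine hom_ext_of_appLE fun W' k' (μ : E.over W' ⟶ (unitModule X).over W') => ?_
  rw [appLE_comp, appLE_restrictHom, appLE_twistHomOfSections, appLE_smul_right, appLE_evalAt,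
    Scheme.Modules.map_smul, appLE_smul_right, presheaf_map_map]
  -- `ν(l|_W)|_{W'} = ν_{W'}(l|_{W'})`
  have hc : (X.presheaf.map k'.op (show Γ(X, W) from appLE ν (𝟙 W) (L.presheaf.map k.op l)) : Γ(X, W')) =
      appLE ν k' (L.presheaf.map (k' ≫ k).op l) := by
    have h := appLE_map ν (𝟙 W) k' (L.presheaf.map k.op l)
    rw [Category.comp_id, presheaf_map_map] at h
    exact h.symm
  -- `μ(s|) · ν(l|) = ν(l|) · μ(s|)` in the commutative ring `Γ(X, W')`
  change (show Γ(X, W') from appLE μ (𝟙 W') (E.presheaf.map (k' ≫ k).op (s : Γ(E, U)))) *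
      (show Γ(X, W') from appLE ν k' (L.presheaf.map (k' ≫ k).op l)) =
    (X.presheaf.map k'.op (show Γ(X, W) from appLE ν (𝟙 W) (L.presheaf.map k.op l))) *
      (show Γ(X, W') from appLE μ (𝟙 W') (E.presheaf.map (k' ≫ k).op (s : Γ(E, U))))
  rw [hc]
  exact mul_comm _ _

end Literature.AlgebraicGeometry.Modules

/-! ### §2 `kodairaSpencerObstruction` in `𝓗om(E^∨, –)`-form -/

namespace Literature.AlgebraicGeometry.HodgeTheory

open CategoryTheory.Abelian CategoryTheory.Limits
open Literature.AlgebraicGeometry.Modules Literature.AlgebraicGeometry.Motives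

universe w

section SheafHomForm

variable {S : Type u} [CommRing S] {X : Over (Spec (CommRingCat.of S))} [HasExt.{w} X.left.Modules]
  (hΩ : IsFiniteLocallyFree (cotangentSheaf X)) {E : X.left.Modules} (hE : IsFiniteLocallyFree E)

/-- **The obstruction class in `𝓗om(E^∨, –)`-form**: for `E` and `Ω¹_{X/S}` finite locally free and `κ ∈ Ext¹(Ω¹_{X/S}, 𝒪_X)`,
`ob_κ(E) = At'(E) · (𝓗om(𝒯,E) ≅ E ⊗ Ω¹) · (E ⊗ κ) · ρ_E` (the tree's `kodairaSpencerObstruction`, twist by `E ⊗ –`) EQUALS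
`At(E) · 𝓗om(E^∨, κ) · ev_E⁻¹` (twist by `𝓗om(E^∨, –)`): «`0 = (id_{E₀} ⊗ κ(X₀/X)) ∘ A(E₀) ∈ Ext²(E₀, E₀ ⊗ I)`» read through
«`𝓗om(𝓔, 𝓕) ≅ 𝓔^∨ ⊗ 𝓕`».  Proof: `At' = At · (transpose ≫ 𝓗om(𝒯, ev)⁻¹)` (`atiyahClass'_eq`), naturality of `κ ↦ F(κ)` along
`θ : E ⊗ – ⟶ 𝓗om(E^∨, –)` (`mapExactFunctor_natTrans`), and the degree-`0` identities of §1.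
[cite: HuybrechtsThomas2010, Main Theorem and Cor. 3.4 (arXiv pp. 3, 10)] [cite: Hartshorne1977, II Ex. 5.1 (a), (b) (p. 123)] [cite: BuchweitzFlenner2003, §1 and §3] [cite: Weibel1994, §2.4 (naturality)] -/
theorem kodairaSpencerObstruction_eq_sheafHom_form (κ : Ext.{w} (cotangentSheaf X) (unitModule X.left) 1) :
    kodairaSpencerObstruction hΩ hE κ =
      haveI := preservesFiniteColimits_sheafHomFunctor (dual E) (isFiniteLocallyFree_dual hE)
      haveI := isIso_toBidual E hE
      ((atiyahClass E).comp (κ.mapExactFunctor (sheafHomFunctor (dual E)) :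
          Ext.{w} (twistCotangent E) (dual (dual E)) 1) (rfl : 1 + 1 = 2)).comp
        (Ext.mk₀ (inv (toBidual E (unitModule X.left)))) (add_zero 2) := by
  letI : ((tensorBifunctor X.left).obj E).Additive := additive_tensorBifunctor_obj E
  letI : PreservesFiniteLimits ((tensorBifunctor X.left).obj E) :=
    preservesFiniteLimits_tensorBifunctor_obj_of_isFiniteLocallyFree hE
  letI : PreservesFiniteColimits ((tensorBifunctor X.left).obj E) := preservesFiniteColimits_tensorBifunctor_obj E
  haveI : PreservesFiniteColimits (sheafHomFunctor (dual E)) :=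
    preservesFiniteColimits_sheafHomFunctor (dual E) (isFiniteLocallyFree_dual hE)
  haveI := isIso_toBidual E hE
  haveI := isIso_sheafHomMap_toBidual E hE
  haveI := isIso_transposeDual (dual E) (cotangentSheaf X) (isFiniteLocallyFree_dual hE) hΩ
  -- the two twisting isomorphisms `θ_N : E ⊗ N ≅ 𝓗om(E^∨, N)` at `N = Ω¹, 𝒪`
  set θΩ := tensorSheafHomDualIso E (cotangentSheaf X) hE with hθΩ
  set θO := tensorSheafHomDualIso E (unitModule X.left) hE with hθO
  -- (i) naturality of `κ ↦ F(κ)` in the exact functor, along `θ : E ⊗ – ⟶ 𝓗om(E^∨, –)`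
  have hnat := Literature.Algebra.Homology.ExtFunctoriality.mapExactFunctor_natTrans (tensorSheafHomDualNatTrans E) κ
  rw [tensorSheafHomDualNatTrans_app, tensorSheafHomDualNatTrans_app] at hnat
  have hnat' : (Ext.mk₀ θΩ.hom).comp (κ.mapExactFunctor (sheafHomFunctor (dual E))) (zero_add 1) =
      (κ.mapExactFunctor ((tensorBifunctor X.left).obj E)).comp (Ext.mk₀ θO.hom) (add_zero 1) := hnat
  have hF₂ : κ.mapExactFunctor ((tensorBifunctor X.left).obj E) =
      (((Ext.mk₀ θΩ.hom).comp (κ.mapExactFunctor (sheafHomFunctor (dual E))) (zero_add 1)).comp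
        (Ext.mk₀ θO.inv) (add_zero 1)) := by
    rw [hnat', Ext.comp_assoc_of_third_deg_zero, Ext.mk₀_comp_mk₀, Iso.hom_inv_id, Ext.comp_mk₀_id]
  -- (ii) the degree-0 identities
  have h1 : (twistTranspose E ≫ inv (sheafHomMap (tangentSheaf X) (toBidual E (unitModule X.left)))) ≫
      (tangentHomTensorIso hΩ E).hom ≫ θΩ.hom = 𝟙 _ := by
    rw [← cancel_mono (twistTranspose E)]
    change ((transposeDual (dual E) (cotangentSheaf X) ≫ inv (sheafHomMap (tangentSheaf X) (toBidual E (unitModule X.left)))) ≫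
      ((tensorSheafHomDualIso (cotangentSheaf X) E hΩ).inv ≫ (tensorComm (cotangentSheaf X) E).hom) ≫ θΩ.hom) ≫
        transposeDual (dual E) (cotangentSheaf X) = 𝟙 _ ≫ transposeDual (dual E) (cotangentSheaf X)
    simp only [Category.assoc, Category.id_comp]
    rw [tensorComm_tensorSheafHomDualIso_transposeDual (cotangentSheaf X) E hΩ hE, Iso.inv_hom_id_assoc,
      IsIso.inv_hom_id, Category.comp_id]
  have h2 : θO.inv ≫ (tensorUnitRightIso E).hom = inv (toBidual E (unitModule X.left)) := by
    rw [Iso.inv_comp_eq, ← tensorUnitRightIso_hom_comp_toBidual E hE, Category.assoc, IsIso.hom_inv_id,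
      Category.comp_id]
  -- (iii) assemble: collect the degree-0 factors around `F₁(κ)`
  rw [kodairaSpencerObstruction_def, atiyahClass'_eq E hE, hF₂]
  rw [Ext.comp_assoc_of_second_deg_zero (atiyahClass E), Ext.mk₀_comp_mk₀,
    Ext.comp_assoc_of_third_deg_zero (Ext.mk₀ θΩ.hom),
    Ext.comp_assoc_of_second_deg_zero (atiyahClass E), Ext.mk₀_comp_mk₀_assoc, Category.assoc, h1,
    Ext.mk₀_id_comp, Ext.comp_assoc_of_third_deg_zero (atiyahClass E),
    Ext.comp_assoc_of_third_deg_zero (κ.mapExactFunctor (sheafHomFunctor (dual E))), Ext.mk₀_comp_mk₀, h2,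
    Ext.comp_assoc_of_third_deg_zero (atiyahClass E)]

end SheafHomForm

end Literature.AlgebraicGeometry.HodgeTheory

end
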